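import Summits.NavierStokesRegularity.NavierStokesRegularity.Theorems.PerpetualPumpCircuitPumpClockBoxTable
import Summits.NavierStokesRegularity.NavierStokesRegularity.Theorems.CircuitPump.Negative.CriticalBound
import Summits.NavierStokesRegularity.NavierStokesRegularity.Theorems.WakeRatchetEternalViscousRateCircuitPumpClock
import Literature.NumberTheory.LFunctions.Zhang2022.Section4GaussianWeight

/-!
# `WakeRatchet.EternalViscousRate` (stmt-NavierStokesRegularity-25647) — fixed-seed Toda pumps: the INTEGRATED SHELL-0 IDENTITY
# (a-priori identity for the construction item `FineFixedSeedTodaPumps` of the Negative file p829025; part 1 of 2, tools + identity)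

Every exactly self-similar (period 1), Type-I solution `X = (a, b)` on `(-∞, 0)` of the m = 2 seeded graded Toda circuit `T_ε`
(ANY real seed `ε`) at scale ratio `lam > 1` satisfies, with `E = a_0² + b_0²`, `q = lam^{1/5}`, `r = lam^{4/5}` and
`h(s) = a_0(rs) b_0(s)²`, for every `τ < 0`:

  `E(τ) + 2∫_{≤τ} E = 2q ∫_{≤τ/r} h − 2q⁻¹ ∫_{≤τ} h`     (`shellZero_energy_identity`),

all integrals over left half-lines being absolutely convergent.  PROOF: the shell-0 energy law
`E' = −2E + 2lam⁻¹ a_0 b_{-1}² − 2 a_1 b_0²` (`shellZero_energy_hasDerivAt`; the seed terms cancel), the self-similarity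
`b_{-1}(t) = q b_0(t/r)`, `a_1(t) = q⁻¹ a_0(rt)` (`dss_shell_neg_one`, `dss_shell_one`), the tree's a-priori bounds
`|X_{i,0}| ≤ K`, `(-t)|X_{i,0}(t)| ≤ K` (`typeI_critical_bound`, `typeI_clock_bound`; here `shellZero_bounds`, `shellZero_sq_le`)
which put every term under a `1/(1+t²)` majorant, `E(−∞) = 0`, the fundamental theorem of calculus on `(-∞, τ]` and the
substitution `t ↦ t/r` (the tree's `GaussWeight.integral_comp_mul_left_Iic`; `lam⁻¹ q² r = q`).  The companion file `…CircuitPumpAmplitudeFloor` lets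
`τ ↑ 0` (exhaustion lemmas `tendsto_integral_Iic_neg_div`) and derives the seed-free AMPLITUDE FLOOR
`sup_{t<0} a_0(t) ≥ lam^{1/5}/(lam^{2/5} − 1) ≥ 5/(2(lam−1))` of every non-trivial pump.
HONEST FRAMING: MODEL lattice ODEs only (Tao 2016 §4 circuits); nothing here is a statement about the Navier–Stokes equations; no
registered stub of skeleton 842b1374 is closed; the crux ⟨25647⟩, `FineFixedSeedTodaPumps` and every summit statement remain OPEN.
-/

set_option linter.dupNamespace false

noncomputable section

open scoped BigOperators
open Set Real Filter Topology MeasureTheory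

namespace Summit.NavierStokesRegularity.NavierStokesRegularity.Theorems.WakeRatchetCircuitPumpFloor

open Summit.NavierStokesRegularity.NavierStokesRegularity.Theorems.CircuitPumpNegative
open Summit.NavierStokesRegularity.NavierStokesRegularity.Theorems.PerpetualPumpCircuitPump
open Summit.NavierStokesRegularity.NavierStokesRegularity.Theorems.WakeRatchetCircuitPumpClock

/-! ## Tools: exhaustion of `(-∞,0)`, integrability under a `1/(1+t²)` majorant
(the substitution `∫_{x≤a} g(bx)dx = b⁻¹∫_{x≤ba} g` on a left half-line is the tree's
`Literature.NumberTheory.LFunctions.Zhang2022.GaussWeight.integral_comp_mul_left_Iic`) -/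

/-- The half-lines `(-∞, -c/(n+1)]`, `c > 0`, exhaust `(-∞, 0)`. [folklore] -/
theorem iUnion_Iic_neg_div (c : ℝ) (hc : 0 < c) :
    (⋃ n : ℕ, Iic (-(c / ((n : ℝ) + 1)))) = Iio 0 := by
  ext x
  simp only [mem_iUnion, mem_Iic, mem_Iio]
  constructor
  · rintro ⟨n, hn⟩
    have : 0 < c / ((n : ℝ) + 1) := by positivity
    linarith
  · intro hx
    obtain ⟨n, hn⟩ := exists_nat_one_div_lt (div_pos (neg_pos.2 hx) hc)
    refine ⟨n, ?_⟩
    have h1 : c / ((n : ℝ) + 1) = c * (1 / ((n : ℝ) + 1)) := by ring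
    have h2 : c * (1 / ((n : ℝ) + 1)) < c * (-x / c) := mul_lt_mul_of_pos_left hn hc
    have h3 : c * (-x / c) = -x := by field_simp
    linarith

/-- The half-lines `(-∞, -c/(n+1)]` increase with `n`. [folklore] -/
theorem monotone_Iic_neg_div (c : ℝ) (hc : 0 < c) :
    Monotone (fun n : ℕ => Iic (-(c / ((n : ℝ) + 1)))) := by
  intro m n hmn
  apply Iic_subset_Iic.2
  have hm : (0 : ℝ) < (m : ℝ) + 1 := by positivity
  have hmn' : (m : ℝ) + 1 ≤ (n : ℝ) + 1 := by exact_mod_cast Nat.succ_le_succ hmn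
  have := div_le_div_of_nonneg_left hc.le hm hmn'
  linarith

/-- Exhaustion: for `f` integrable on `(-∞,0)`, `∫_{≤ -c/(n+1)} f → ∫_{<0} f`. [folklore] -/
theorem tendsto_integral_Iic_neg_div {f : ℝ → ℝ} (hf : IntegrableOn f (Iio 0)) (c : ℝ) (hc : 0 < c) :
    Tendsto (fun n : ℕ => ∫ x in Iic (-(c / ((n : ℝ) + 1))), f x) atTop (𝓝 (∫ x in Iio 0, f x)) := by
  have h := tendsto_setIntegral_of_monotone (μ := volume) (f := f) (fun n => measurableSet_Iic)
    (monotone_Iic_neg_div c hc) (by rw [iUnion_Iic_neg_div c hc]; exact hf)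
  rwa [iUnion_Iic_neg_div c hc] at h

/-- A function continuous on `(-∞,0)` with `|f t| ≤ M/(1+t²)` there is integrable on `(-∞,0)`. [folklore] -/
theorem integrableOn_Iio_of_le_inv_one_add_sq {f : ℝ → ℝ} (hcont : ContinuousOn f (Iio 0)) {M : ℝ}
    (hbd : ∀ t : ℝ, t < 0 → |f t| ≤ M / (1 + t ^ 2)) : IntegrableOn f (Iio 0) := by
  have hg : IntegrableOn (fun t : ℝ => M * (1 + t ^ 2)⁻¹) (Iio 0) :=
    (integrable_inv_one_add_sq.const_mul M).integrableOn
  refine Integrable.mono' hg (hcont.aestronglyMeasurable measurableSet_Iio) ?_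
  refine ae_restrict_of_forall_mem measurableSet_Iio fun t ht => ?_
  rw [Real.norm_eq_abs, ← div_eq_mul_inv]
  exact hbd t ht

/-! ## A-priori bounds at shell `0` (any table): bounded near `t = 0`, `O(1/|t|)` in the far past -/

variable {m : ℕ}

/-- For a Type-I circuit solution (any table), the shell-`0` modes obey `|X_{i,0}(t)| ≤ K` and `(-t)|X_{i,0}(t)| ≤ K`
for one constant `K ≥ 0` (tree: `typeI_critical_bound`, `typeI_clock_bound` at `n = 0`). -/
theorem shellZero_bounds {lam : ℝ} (hlam : 1 < lam) (coeff : Fin m → Fin m → Fin m → Option (Fin 3) → ℝ)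
    (X : Fin m → ℤ → ℝ → ℝ) (hode : SolvesODE lam coeff X) (hTI : IsTypeI lam X) :
    ∃ K : ℝ, 0 ≤ K ∧ (∀ (i : Fin m) (t : ℝ), t < 0 → |X i 0 t| ≤ K) ∧
      ∀ (i : Fin m) (t : ℝ), t < 0 → (-t) * |X i 0 t| ≤ K := by
  obtain ⟨C', hC'⟩ := typeI_critical_bound hlam coeff X hode hTI
  obtain ⟨K, hK⟩ := typeI_clock_bound hlam coeff X hode hTI
  refine ⟨max (max C' K) 0, le_max_right _ _, fun i t ht => ?_, fun i t ht => ?_⟩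
  · have h := hC' i 0 t ht
    simp only [Int.cast_zero, mul_zero, Real.rpow_zero, one_mul] at h
    exact h.trans ((le_max_left _ _).trans (le_max_left _ _))
  · have h := hK i 0 t ht
    simp only [Int.cast_zero, Real.rpow_zero, one_mul] at h
    exact h.trans ((le_max_right _ _).trans (le_max_left _ _))

/-- The `1/(1+t²)` majorant of a squared shell-`0` mode: `X_{i,0}(t)² ≤ 2K²/(1+t²)` on `(-∞,0)`. -/
theorem shellZero_sq_le {lam : ℝ} (hlam : 1 < lam) (coeff : Fin m → Fin m → Fin m → Option (Fin 3) → ℝ)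
    (X : Fin m → ℤ → ℝ → ℝ) (hode : SolvesODE lam coeff X) (hTI : IsTypeI lam X) :
    ∃ K : ℝ, 0 ≤ K ∧ (∀ (i : Fin m) (t : ℝ), t < 0 → |X i 0 t| ≤ K) ∧
      ∀ (i : Fin m) (t : ℝ), t < 0 → X i 0 t ^ 2 ≤ 2 * K ^ 2 / (1 + t ^ 2) := by
  obtain ⟨K, hK0, hb, hc⟩ := shellZero_bounds hlam coeff X hode hTI
  refine ⟨K, hK0, hb, fun i t ht => ?_⟩
  have h1t : 0 < 1 + t ^ 2 := by positivity
  rw [le_div_iff₀ h1t]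
  by_cases h1 : -1 ≤ t
  · -- near zero: `X² ≤ K²` and `1 + t² ≤ 2`
    have hx : X i 0 t ^ 2 ≤ K ^ 2 := by
      have := hb i t ht
      rw [← sq_abs]
      exact pow_le_pow_left₀ (abs_nonneg _) this 2
    have ht2 : t ^ 2 ≤ 1 := by nlinarith
    nlinarith [sq_nonneg (X i 0 t)]
  · -- far past: `t²X² ≤ K²` and `1 + t² ≤ 2t²`
    push Not at h1
    have hx : ((-t) * |X i 0 t|) ^ 2 ≤ K ^ 2 :=
      pow_le_pow_left₀ (mul_nonneg (by linarith) (abs_nonneg _)) (hc i t ht) 2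
    have he : ((-t) * |X i 0 t|) ^ 2 = t ^ 2 * X i 0 t ^ 2 := by rw [mul_pow, sq_abs]; ring
    rw [he] at hx
    have ht2 : 1 ≤ t ^ 2 := by nlinarith
    nlinarith [sq_nonneg (X i 0 t)]

/-! ## The Toda instance: shell-`0` energy law, self-similarity at period 1 -/

/-- Period-1 self-similarity, unpacked: `X_{i,n+1}(lam^{-4/5} t) = lam^{-1/5} X_{i,n}(t)`. -/
theorem dss_one {lam : ℝ} {X : Fin m → ℤ → ℝ → ℝ} (hdss : IsDSS lam 1 X) (i : Fin m) (n : ℤ) (t : ℝ)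
    (ht : t < 0) : X i (n + 1) (lam ^ (-(4 / 5 : ℝ)) * t) = lam ^ (-(1 / 5 : ℝ)) * X i n t := by
  have h := hdss i n t ht
  simpa using h

/-- The shell above: `X_{i,1}(t) = lam^{-1/5} X_{i,0}(lam^{4/5} t)`. -/
theorem dss_shell_one {lam : ℝ} (hlam : 1 < lam) {X : Fin m → ℤ → ℝ → ℝ} (hdss : IsDSS lam 1 X)
    (i : Fin m) (t : ℝ) (ht : t < 0) :
    X i 1 t = lam ^ (-(1 / 5 : ℝ)) * X i 0 (lam ^ (4 / 5 : ℝ) * t) := by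
  have hpos : 0 < lam := by linarith
  have hr : 0 < lam ^ (4 / 5 : ℝ) := Real.rpow_pos_of_pos hpos _
  have h := dss_one hdss i 0 (lam ^ (4 / 5 : ℝ) * t) (mul_neg_of_pos_of_neg hr ht)
  have e : lam ^ (-(4 / 5 : ℝ)) * (lam ^ (4 / 5 : ℝ) * t) = t := by
    rw [← mul_assoc, ← Real.rpow_add hpos]; norm_num
  rw [e, zero_add] at h
  exact h

/-- The shell below: `X_{i,-1}(t) = lam^{1/5} X_{i,0}(lam^{-4/5} t)`. -/
theorem dss_shell_neg_one {lam : ℝ} (hlam : 1 < lam) {X : Fin m → ℤ → ℝ → ℝ} (hdss : IsDSS lam 1 X)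
    (i : Fin m) (t : ℝ) (ht : t < 0) :
    X i (-1) t = lam ^ (1 / 5 : ℝ) * X i 0 (lam ^ (-(4 / 5 : ℝ)) * t) := by
  have h := dss_down hlam hdss i 0 t ht
  simpa using h

/-- **Shell-`0` energy law of the Toda circuit.**  For a solution of `T_ε` on `(-∞,0)` (any real `ε`), `E = a_0² + b_0²` has
`E' = −2E + 2lam⁻¹ a_0 b_{-1}² − 2 a_1 b_0²` (the seed terms cancel; flux in from shell `−1`, flux out to shell `1`). -/
theorem shellZero_energy_hasDerivAt {lam ε : ℝ} (hlam : 1 < lam) (X : Fin 2 → ℤ → ℝ → ℝ)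
    (hode : SolvesODE lam (fun (i₁ i₂ i₃ : Fin 2) (μ : Option (Fin 3)) => if μ = none then (if i₁ = 1 ∧ i₂ = 1 ∧ i₃ = 0
                then (-1 : ℝ) else if i₁ = 1 ∧ i₂ = 0 ∧ i₃ = 1 then 1 / 2 else if i₁ = 0 ∧ i₂ = 1 ∧ i₃ = 1
                then 1 / 2 else if i₁ = 0 ∧ i₂ = 0 ∧ i₃ = 1 then ε else if i₁ = 0 ∧ i₂ = 1 ∧ i₃ = 0 then -ε /
                2 else if i₁ = 1 ∧ i₂ = 0 ∧ i₃ = 0 then -ε / 2 else 0) else if μ = some 2 then (if i₁ = 1 ∧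
                i₂ = 1 ∧ i₃ = 0 then 1 else 0) else if μ = some 1 then (if i₁ = 1 ∧ i₂ = 0 ∧ i₃ = 1 then -1 /
                2 else 0) else (if i₁ = 0 ∧ i₂ = 1 ∧ i₃ = 1 then -1 / 2 else 0)) X)
    (t : ℝ) (ht : t < 0) :
    HasDerivAt (fun s => X 0 0 s ^ 2 + X 1 0 s ^ 2)
      (-2 * (X 0 0 t ^ 2 + X 1 0 t ^ 2) + 2 * lam⁻¹ * X 0 0 t * X 1 (-1) t ^ 2 - 2 * X 0 1 t * X 1 0 t ^ 2) t := by
  have hpos : 0 < lam := by linarith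
  have ha := hode 0 0 t ht
  have hb := hode 1 0 t ht
  rw [toda_rhsF_zero] at ha
  rw [toda_rhsF_one] at hb
  simp only [Int.cast_zero, mul_zero, Real.rpow_zero, one_mul, zero_sub, zero_add, mul_one] at ha hb
  rw [Real.rpow_neg_one] at ha
  have h2 := (ha.pow 2).add (hb.pow 2)
  refine h2.congr_deriv ?_
  simp only [Nat.cast_ofNat]
  ring

/-! ## The integrated identity -/

/-- **The integrated shell-`0` identity.**  For a period-1 self-similar Type-I solution of `T_ε` and every `τ < 0`, with
`E = a_0² + b_0²`, `h(s) = a_0(lam^{4/5}s) b_0(s)²`, `q = lam^{1/5}`: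
`E(τ) + 2∫_{≤τ} E = 2q ∫_{≤ lam^{-4/5}τ} h − 2q⁻¹ ∫_{≤τ} h`, all integrals over left half-lines being absolutely convergent. -/
theorem shellZero_energy_identity {lam ε : ℝ} (hlam : 1 < lam) (X : Fin 2 → ℤ → ℝ → ℝ)
    (hode : SolvesODE lam (fun (i₁ i₂ i₃ : Fin 2) (μ : Option (Fin 3)) => if μ = none then (if i₁ = 1 ∧ i₂ = 1 ∧ i₃ = 0
                then (-1 : ℝ) else if i₁ = 1 ∧ i₂ = 0 ∧ i₃ = 1 then 1 / 2 else if i₁ = 0 ∧ i₂ = 1 ∧ i₃ = 1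
                then 1 / 2 else if i₁ = 0 ∧ i₂ = 0 ∧ i₃ = 1 then ε else if i₁ = 0 ∧ i₂ = 1 ∧ i₃ = 0 then -ε /
                2 else if i₁ = 1 ∧ i₂ = 0 ∧ i₃ = 0 then -ε / 2 else 0) else if μ = some 2 then (if i₁ = 1 ∧
                i₂ = 1 ∧ i₃ = 0 then 1 else 0) else if μ = some 1 then (if i₁ = 1 ∧ i₂ = 0 ∧ i₃ = 1 then -1 /
                2 else 0) else (if i₁ = 0 ∧ i₂ = 1 ∧ i₃ = 1 then -1 / 2 else 0)) X)
    (hdss : IsDSS lam 1 X) (hTI : IsTypeI lam X) :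
    IntegrableOn (fun s => X 0 0 s ^ 2 + X 1 0 s ^ 2) (Iio 0) ∧
    IntegrableOn (fun s => X 0 0 (lam ^ (4 / 5 : ℝ) * s) * X 1 0 s ^ 2) (Iio 0) ∧
    ∀ τ : ℝ, τ < 0 →
      (X 0 0 τ ^ 2 + X 1 0 τ ^ 2) + 2 * ∫ s in Iic τ, (X 0 0 s ^ 2 + X 1 0 s ^ 2) =
        2 * lam ^ (1 / 5 : ℝ) * (∫ s in Iic (lam ^ (-(4 / 5 : ℝ)) * τ), X 0 0 (lam ^ (4 / 5 : ℝ) * s) * X 1 0 s ^ 2)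
          - 2 * lam ^ (-(1 / 5 : ℝ)) * (∫ s in Iic τ, X 0 0 (lam ^ (4 / 5 : ℝ) * s) * X 1 0 s ^ 2) := by
  have hpos : 0 < lam := by linarith
  set q : ℝ := lam ^ (1 / 5 : ℝ) with hq
  set r : ℝ := lam ^ (4 / 5 : ℝ) with hr
  have hq0 : 0 < q := Real.rpow_pos_of_pos hpos _
  have hr0 : 0 < r := Real.rpow_pos_of_pos hpos _
  have hr1 : 1 ≤ r := Real.one_le_rpow hlam.le (by norm_num)
  have hqinv : lam ^ (-(1 / 5 : ℝ)) = q⁻¹ := by rw [hq, Real.rpow_neg hpos.le]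
  have hrinv : lam ^ (-(4 / 5 : ℝ)) = r⁻¹ := by rw [hr, Real.rpow_neg hpos.le]
  -- the modes at shell 0 are continuous on `(-∞,0)`
  have hca : ∀ i : Fin 2, ContinuousOn (fun s => X i 0 s) (Iio 0) := fun i s hs =>
    (hode i 0 s hs).continuousAt.continuousWithinAt
  have hcar : ContinuousOn (fun s => X 0 0 (r * s)) (Iio 0) := by
    intro s hs
    have hrs : r * s < 0 := mul_neg_of_pos_of_neg hr0 hs
    have h1 : ContinuousAt (fun s => X 0 0 s) (r * s) := (hode 0 0 (r * s) hrs).continuousAt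
    exact (h1.comp (continuous_const.mul continuous_id).continuousAt).continuousWithinAt
  -- majorants
  obtain ⟨K, hK0, hKb, hKsq⟩ := shellZero_sq_le hlam _ X hode hTI
  set E : ℝ → ℝ := fun s => X 0 0 s ^ 2 + X 1 0 s ^ 2 with hE
  set h : ℝ → ℝ := fun s => X 0 0 (r * s) * X 1 0 s ^ 2 with hh
  have hEbd : ∀ t : ℝ, t < 0 → |E t| ≤ (4 * K ^ 2) / (1 + t ^ 2) := by
    intro t ht
    have h0 := hKsq 0 t ht
    have h1 := hKsq 1 t ht
    have hEt : 0 ≤ E t := by positivity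
    rw [abs_of_nonneg hEt]
    have : 2 * K ^ 2 / (1 + t ^ 2) + 2 * K ^ 2 / (1 + t ^ 2) = 4 * K ^ 2 / (1 + t ^ 2) := by ring
    linarith
  have hhbd : ∀ t : ℝ, t < 0 → |h t| ≤ (K * (2 * K ^ 2)) / (1 + t ^ 2) := by
    intro t ht
    have hrt : r * t < 0 := mul_neg_of_pos_of_neg hr0 ht
    have h0 := hKb 0 (r * t) hrt
    have h1 := hKsq 1 t ht
    simp only [hh, abs_mul, abs_pow, sq_abs]
    rw [mul_div_assoc]
    exact mul_le_mul h0 h1 (sq_nonneg _) hK0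
  have hhrbd : ∀ t : ℝ, t < 0 → |h (r⁻¹ * t)| ≤ (K * (2 * K ^ 2) * r ^ 2) / (1 + t ^ 2) := by
    intro t ht
    have hrt : r⁻¹ * t < 0 := mul_neg_of_pos_of_neg (inv_pos.2 hr0) ht
    have h1 := hhbd (r⁻¹ * t) hrt
    refine h1.trans ?_
    have h1t : 0 < 1 + t ^ 2 := by positivity
    have h1rt : 0 < 1 + (r⁻¹ * t) ^ 2 := by positivity
    rw [div_le_div_iff₀ h1rt h1t]
    have hr2 : 1 ≤ r ^ 2 := one_le_pow₀ hr1
    have hKK : 0 ≤ K * (2 * K ^ 2) := by positivity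
    have key : 1 + t ^ 2 ≤ (1 + (r⁻¹ * t) ^ 2) * r ^ 2 := by
      have e : (1 + (r⁻¹ * t) ^ 2) * r ^ 2 = r ^ 2 + t ^ 2 := by field_simp
      rw [e]; linarith
    calc K * (2 * K ^ 2) * (1 + t ^ 2) ≤ K * (2 * K ^ 2) * ((1 + (r⁻¹ * t) ^ 2) * r ^ 2) :=
          mul_le_mul_of_nonneg_left key hKK
      _ = K * (2 * K ^ 2) * r ^ 2 * (1 + (r⁻¹ * t) ^ 2) := by ring
  -- integrability on `(-∞,0)`
  have hEc : ContinuousOn E (Iio 0) := ((hca 0).pow 2).add ((hca 1).pow 2)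
  have hhc : ContinuousOn h (Iio 0) := hcar.mul ((hca 1).pow 2)
  have hhrc : ContinuousOn (fun s => h (r⁻¹ * s)) (Iio 0) := by
    intro s hs
    have hrs : r⁻¹ * s < 0 := mul_neg_of_pos_of_neg (inv_pos.2 hr0) hs
    have h1 : ContinuousAt h (r⁻¹ * s) := (hhc (r⁻¹ * s) hrs).continuousAt (Iio_mem_nhds hrs)
    exact (h1.comp (continuous_const.mul continuous_id).continuousAt).continuousWithinAt
  have hEi : IntegrableOn E (Iio 0) := integrableOn_Iio_of_le_inv_one_add_sq hEc hEbd
  have hhi : IntegrableOn h (Iio 0) := integrableOn_Iio_of_le_inv_one_add_sq hhc hhbd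
  have hhri : IntegrableOn (fun s => h (r⁻¹ * s)) (Iio 0) := integrableOn_Iio_of_le_inv_one_add_sq hhrc hhrbd
  refine ⟨hEi, hhi, fun τ hτ => ?_⟩
  -- the derivative of E on `(-∞,0)` in terms of h
  have hderiv : ∀ t ∈ Iio τ, HasDerivAt E (-2 * E t + 2 * lam⁻¹ * q ^ 2 * h (r⁻¹ * t) - 2 * q⁻¹ * h t) t := by
    intro t ht
    have ht0 : t < 0 := lt_trans ht hτ
    have hd := shellZero_energy_hasDerivAt hlam X hode t ht0
    refine hd.congr_deriv ?_
    have e1 : X 1 (-1) t = q * X 1 0 (r⁻¹ * t) := by rw [dss_shell_neg_one hlam hdss 1 t ht0, hrinv]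
    have e2 : X 0 1 t = q⁻¹ * X 0 0 (r * t) := by rw [dss_shell_one hlam hdss 0 t ht0, hqinv]
    have e3 : h (r⁻¹ * t) = X 0 0 t * X 1 0 (r⁻¹ * t) ^ 2 := by
      simp only [hh]; rw [mul_inv_cancel_left₀ hr0.ne']
    rw [e1, e2, e3]
    simp only [hE, hh]
    ring
  -- integrability on `(-∞,τ]`
  have hsub : Iic τ ⊆ Iio 0 := fun s hs => lt_of_le_of_lt hs hτ
  have hEiτ : IntegrableOn E (Iic τ) := hEi.mono_set hsub
  have hhiτ : IntegrableOn h (Iic τ) := hhi.mono_set hsub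
  have hhriτ : IntegrableOn (fun s => h (r⁻¹ * s)) (Iic τ) := hhri.mono_set hsub
  have hDi : IntegrableOn (fun t => -2 * E t + 2 * lam⁻¹ * q ^ 2 * h (r⁻¹ * t) - 2 * q⁻¹ * h t) (Iic τ) :=
    ((hEiτ.const_mul (-2)).add (hhriτ.const_mul (2 * lam⁻¹ * q ^ 2))).sub (hhiτ.const_mul (2 * q⁻¹))
  -- E → 0 at −∞ (Type I)
  have hE0 : Tendsto E atBot (𝓝 0) := by
    have hsq : Tendsto (fun t : ℝ => 1 + t ^ 2) atBot atTop := by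
      have : Tendsto (fun t : ℝ => t ^ 2) atBot atTop := by
        simpa [sq] using Filter.Tendsto.atBot_mul_atBot₀ tendsto_id tendsto_id
      exact tendsto_atTop_add_const_left _ _ this
    have hmaj : Tendsto (fun t : ℝ => 4 * K ^ 2 / (1 + t ^ 2)) atBot (𝓝 0) :=
      tendsto_const_nhds.div_atTop hsq
    refine tendsto_of_tendsto_of_tendsto_of_le_of_le' tendsto_const_nhds hmaj ?_ ?_
    · exact Eventually.of_forall fun t => by positivity
    · filter_upwards [eventually_lt_atBot (0 : ℝ)] with t ht
      exact (le_abs_self _).trans (hEbd t ht)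
  -- FTC on `(-∞, τ]`
  have hcont : ContinuousWithinAt E (Iic τ) τ :=
    (shellZero_energy_hasDerivAt hlam X hode τ hτ).continuousAt.continuousWithinAt
  have hFTC := integral_Iic_of_hasDerivAt_of_tendsto hcont hderiv hDi hE0
  rw [sub_zero] at hFTC
  -- split the integral
  have hf1 : Integrable (fun t => -2 * E t) (volume.restrict (Iic τ)) := hEiτ.const_mul (-2)
  have hf2 : Integrable (fun t => 2 * lam⁻¹ * q ^ 2 * h (r⁻¹ * t)) (volume.restrict (Iic τ)) :=
    hhriτ.const_mul (2 * lam⁻¹ * q ^ 2)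
  have hf3 : Integrable (fun t => 2 * q⁻¹ * h t) (volume.restrict (Iic τ)) := hhiτ.const_mul (2 * q⁻¹)
  have hf12 : Integrable (fun t => -2 * E t + 2 * lam⁻¹ * q ^ 2 * h (r⁻¹ * t)) (volume.restrict (Iic τ)) :=
    hf1.add hf2
  have hsplit : ∫ t in Iic τ, (-2 * E t + 2 * lam⁻¹ * q ^ 2 * h (r⁻¹ * t) - 2 * q⁻¹ * h t) =
      -2 * (∫ t in Iic τ, E t) + 2 * lam⁻¹ * q ^ 2 * (∫ t in Iic τ, h (r⁻¹ * t)) - 2 * q⁻¹ * ∫ t in Iic τ, h t := by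
    rw [integral_sub hf12 hf3, integral_add hf1 hf2, integral_const_mul, integral_const_mul, integral_const_mul]
  -- substitute in the inflow integral
  have hsubst : ∫ t in Iic τ, h (r⁻¹ * t) = r * ∫ t in Iic (r⁻¹ * τ), h t := by
    rw [Literature.NumberTheory.LFunctions.Zhang2022.GaussWeight.integral_comp_mul_left_Iic h τ (inv_pos.2 hr0), inv_inv]
  -- `lam⁻¹ q² r = q`
  have hqr : lam⁻¹ * q ^ 2 * r = q := by
    have e1 : q ^ 2 = lam ^ (2 / 5 : ℝ) := by
      rw [hq, ← Real.rpow_natCast, ← Real.rpow_mul hpos.le]; norm_num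
    rw [e1, hr, hq, ← Real.rpow_neg_one, ← Real.rpow_add hpos, ← Real.rpow_add hpos]
    norm_num
  rw [hsplit, hsubst] at hFTC
  have hfin : 2 * lam⁻¹ * q ^ 2 * (r * ∫ t in Iic (r⁻¹ * τ), h t) = 2 * q * ∫ t in Iic (r⁻¹ * τ), h t := by
    calc 2 * lam⁻¹ * q ^ 2 * (r * ∫ t in Iic (r⁻¹ * τ), h t)
        = 2 * (lam⁻¹ * q ^ 2 * r) * ∫ t in Iic (r⁻¹ * τ), h t := by ring
      _ = 2 * q * ∫ t in Iic (r⁻¹ * τ), h t := by rw [hqr]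
  rw [hfin] at hFTC
  rw [hrinv, hqinv]
  simp only [hE, hh] at hFTC ⊢
  linarith

end Summit.NavierStokesRegularity.NavierStokesRegularity.Theorems.WakeRatchetCircuitPumpFloor

end
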